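import Literature.Combinatorics.LorentzianPolynomials.Quadratic
import Literature.Combinatorics.LorentzianPolynomials.ElementarySymmetric
import HarnessLib

/-!
# The basis generating polynomial of a matroid is Lorentzian (Brändén–Huh 2020, Theorem 3.10 for `0/1` sets;
# Anari–Liu–Oveis Gharan–Vinzant)

Layer `Literature/Combinatorics/LorentzianPolynomials`, namespace `Literature.Combinatorics.LorentzianPolynomials`;
lane `lit-hodgefound` (Track 2 foundations library), seat p16, generation 27 (row g27-#10). Sequel of `Quadratic.lean` (row
g27-#7: Theorem 2.25 as the criterion `mem_lorentzian_iff_forall_sigPos_hessian`) and `ElementarySymmetric.lean` (row g27-#5: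
squarefree exponents `ind t`, `normCoeff_eq_coeff_of_le_one`; the uniform matroid).

## Source (verbatim) — P. Brändén, J. Huh, *Lorentzian polynomials* [BrandenHuh2019] (held `paper:arxiv-1902.03719`)

* §2.2 (p. 11): "A matroid `M` on `[n]` is a nonempty family of subsets `B` of `[n]`, called the set of bases of `M`, that
  satisfies the exchange property: For any `B_1, B_2 ∈ B` and `i ∈ B_1 ∖ B_2`, there is `j ∈ B_2 ∖ B_1` such that
  `(B_1 ∖ i) ∪ j ∈ B`. […] we define a subset `J ⊆ ℕ^n` to be M-convex if […] For any `α, β ∈ J` and any index `i` satisfying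
  `α_i > β_i`, there is an index `j` satisfying `α_j < β_j` and `α - e_i + e_j ∈ J`." and "The restriction of [M-convexity] to
  the subsets of `{0,1}^n` gives the family of matroids on `[n]`."
* §3.2 **Theorem 3.10**: "The following conditions are equivalent for any nonempty `J ⊆ Δ^d_n`: (1) There is a Lorentzian
  polynomial whose support is `J`. (2) `f_J = Σ_{α ∈ J} w^α/α!` is Lorentzian. (3) `J` is M-convex."; §1 (p. 5): "the basis
  generating polynomial of any matroid is Lorentzian" (attributed to [ALOGV18]: N. Anari, K. Liu, S. Oveis Gharan, C. Vinzant,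
  *Log-concave polynomials III*).
* §2.4 Theorem 2.25 (the criterion); §2.2 Definition 2.6.

## The proof formalized here (the `0/1` case of (3) ⇒ (2))

Let `J ⊆ {0,1}^σ ∩ Δ^d` be M-convex — the set of bases of a matroid of rank `d`, read as `0/1` vectors — and
`f_J = Σ_{α ∈ J} w^α` (`genPoly J`; `α! = 1`). By Theorem 2.25's criterion it suffices that for every `α ∈ Δ^{d-2}` the
matrix `𝓗_{∂^α f_J} = ([α + e_i + e_j ∈ J])_{i,j}` has at most one positive eigenvalue. This is the adjacency matrix `A` of
the "basis graph of the contraction `J/α`" (`i ~ j` iff `α + e_i + e_j ∈ J`), and the exchange property of `J` makes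
NON-adjacency transitive among non-isolated vertices (`sigPos` part, §2: if `i ≁ j`, `j ≁ k`, `j` not isolated, then
`i ≁ k` — a rank-`2` matroid is a complete multipartite graph on its non-loops plus loops). Hence, with `V'` the
non-isolated vertices partitioned into the classes `C` of `≁`, `xᵀ A x = (Σ_{V'} x_i)² - Σ_C (Σ_C x_i)²`, which is `≤ 0`
on the hyperplane `Σ_{V'} x_i = 0`; by Sylvester `sigPos A ≤ 1`.

## What is here

* §1 `genPoly J = Σ_{α ∈ J} w^α` (`coeff_genPoly`, `support_genPoly`, `isHomogeneous_genPoly`, `normCoeff_genPoly` for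
  squarefree `J`), `IsMConvex.vadd_mem` (the contraction `{γ : α + γ ∈ J}` of an M-convex set is M-convex).
* §2 **`sigPos_le_one_of_nonadj_trans`**: the adjacency matrix of a finite graph in which non-adjacency is transitive
  through non-isolated vertices (a complete multipartite graph plus isolated vertices) has at most one positive eigenvalue.
* §3 `nonadj_trans_of_isMConvex` (the exchange property of `J` gives that hypothesis for `i ~ j ⟺ α + e_i + e_j ∈ J`),
  `hessian_iterPderiv_genPoly`, and **`genPoly_mem_lorentzian`**: for `J ⊆ {0,1}^σ ∩ Δ^d` M-convex,
  `Σ_{α ∈ J} w^α ∈ L^d_n` — THE BASIS GENERATING POLYNOMIAL OF A MATROID IS LORENTZIAN.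

One definition with body (`genPoly`), theorems otherwise; no `sorry`, no named fact (net debt 0). NOT claimed: Theorem 3.10
for general (non-`0/1`) M-convex `J`, and the converses (1) ⇒ (3) (in the tree: `isMConvex_support_of_mem_lorentzian`) ⇒ here
only (3) ⇒ (2) for `0/1` sets.

## References

* [BrandenHuh2019] P. Brändén, J. Huh, *Lorentzian polynomials*, Ann. of Math. (2) 192 (2020) 821–891, arXiv:1902.03719 —
  §1 (p. 5), §2.2 (p. 11), Def. 2.6, §2.4 Thm. 2.25, §3.2 Thm. 3.10.
-/

noncomputable section

open MvPolynomial Finsupp Finset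
open scoped Nat

namespace Literature.Combinatorics.LorentzianPolynomials

variable {σ : Type*}

/-! ## §1 The generating polynomial `f_J = Σ_{α ∈ J} w^α` of a finite set of exponents -/

section GenPoly

/-- **The generating polynomial `f_J = Σ_{α ∈ J} w^α`** of a finite set `J` of exponents (for `J ⊆ {0,1}^n`, Brändén–Huh's
`f_J = Σ_{α∈J} w^α/α!`; for `J` the bases of a matroid, its basis generating polynomial). [cite: BrandenHuh2019, §3.2 Thm. 3.10
("`f_J = Σ_{α ∈ J} w^α/α!`")] -/
def genPoly (J : Finset (σ →₀ ℕ)) : MvPolynomial σ ℝ := ∑ α ∈ J, monomial α 1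

/-- `f_J` unfolded. [cite: BrandenHuh2019, §3.2 Thm. 3.10] -/
theorem genPoly_def (J : Finset (σ →₀ ℕ)) : genPoly J = ∑ α ∈ J, monomial α 1 := rfl

variable [DecidableEq σ]

/-- `coeff_β f_J = [β ∈ J]`. [cite: BrandenHuh2019, §3.2 Thm. 3.10] -/
theorem coeff_genPoly (J : Finset (σ →₀ ℕ)) (β : σ →₀ ℕ) : coeff β (genPoly J) = if β ∈ J then 1 else 0 := by
  rw [genPoly, coeff_sum]
  simp_rw [coeff_monomial]
  exact Finset.sum_ite_eq' J β fun _ ↦ (1 : ℝ)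

/-- The coefficients of `f_J` are `0` or `1`, hence nonnegative. [cite: BrandenHuh2019, §3.2 Thm. 3.10] -/
theorem coeff_genPoly_nonneg (J : Finset (σ →₀ ℕ)) (β : σ →₀ ℕ) : 0 ≤ coeff β (genPoly J) := by
  rw [coeff_genPoly]; split_ifs <;> norm_num

/-- `supp f_J = J`. [cite: BrandenHuh2019, §3.2 Thm. 3.10 ("whose support is `J`")] -/
theorem support_genPoly (J : Finset (σ →₀ ℕ)) : {β : σ →₀ ℕ | coeff β (genPoly J) ≠ 0} = (J : Set (σ →₀ ℕ)) := by
  ext β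
  rw [Set.mem_setOf_eq, coeff_genPoly, Finset.mem_coe]
  split_ifs with h <;> simp [h]

omit [DecidableEq σ] in
/-- `f_J` is homogeneous of degree `d` when `J ⊆ Δ^d`. [cite: BrandenHuh2019, §3.2 Thm. 3.10 ("`J ⊆ Δ^d_n`")] -/
theorem isHomogeneous_genPoly {J : Finset (σ →₀ ℕ)} {d : ℕ} (hJd : ∀ α ∈ J, α.degree = d) :
    (genPoly J).IsHomogeneous d := by
  rw [genPoly]
  exact IsHomogeneous.sum _ _ _ fun α hα ↦ isHomogeneous_monomial _ (hJd α hα)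

/-- For squarefree `J` (`J ⊆ {0,1}^n`) the normalized coefficients of `f_J` are `[β ∈ J]` too (`β! = 1`).
[cite: BrandenHuh2019, §3.2 Thm. 3.10 (`w^α/α!` with `α! = 1` on `{0,1}^n`)] -/
theorem normCoeff_genPoly [Fintype σ] {J : Finset (σ →₀ ℕ)} (hJ01 : ∀ α ∈ J, ∀ i, α i ≤ 1) (β : σ →₀ ℕ) :
    normCoeff β (genPoly J) = if β ∈ J then 1 else 0 := by
  by_cases hβ : β ∈ J
  · rw [normCoeff_eq_coeff_of_le_one (hJ01 β hβ), coeff_genPoly]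
  · rw [normCoeff, coeff_genPoly, if_neg hβ, mul_zero]

omit [DecidableEq σ] in
/-- **The contraction `J/α = {γ : α + γ ∈ J}` of an M-convex set is M-convex** (exchange partners for `α + γ`, `α + δ` are
exchange partners for `γ`, `δ`). [cite: BrandenHuh2019, §2.2 (p. 11, exchange property); §3.2 proof of Thm. 3.10] -/
theorem IsMConvex.vadd_mem {J : Set (σ →₀ ℕ)} (hJ : IsMConvex J) (α : σ →₀ ℕ) : IsMConvex {γ | α + γ ∈ J} := by
  classical
  intro γ δ hγ hδ i hi
  obtain ⟨j, hj, hmem⟩ := hJ hγ hδ i (by rw [Finsupp.add_apply, Finsupp.add_apply]; omega)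
  rw [Finsupp.add_apply, Finsupp.add_apply] at hj
  refine ⟨j, by omega, ?_⟩
  rw [Set.mem_setOf_eq]
  have hγi : γ i ≠ 0 := by omega
  convert hmem using 1
  rw [← Finsupp.sub_add_single_one_cancel hγi]
  ext k
  simp only [Finsupp.add_apply, Finsupp.tsub_apply, Finsupp.single_apply]
  split_ifs <;> omega

end GenPoly

/-! ## §2 Complete multipartite graphs: adjacency matrices with at most one positive eigenvalue -/

section Multipartite

variable [Fintype σ] [DecidableEq σ] (A : σ → σ → Prop) [DecidableRel A]

/-- **The adjacency matrix of a graph in which non-adjacency is transitive through non-isolated vertices has at most one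
positive eigenvalue.** Hypotheses: `A` symmetric and irreflexive, and `i ≁ j`, `j ≁ k`, `j` non-isolated `⟹ i ≁ k` — the graph
is complete multipartite on its non-isolated vertices `V'`, with parts the classes `C` of `≁`. Then
`xᵀ A x = (Σ_{V'} x_i)² - Σ_C (Σ_C x_i)² ≤ 0` on the hyperplane `Σ_{V'} x_i = 0`, so `sigPos ≤ 1` by Sylvester (Mathlib's
`QuadraticForm.sigPos_add_finrank_le_of_nonpos`). This is the signature computation behind "the basis generating polynomial of
a rank-`2` matroid is Lorentzian". [cite: BrandenHuh2019, §3.2 proof of Thm. 3.10 (the quadratic case); §2.1 Lemma 2.5] -/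
theorem sigPos_le_one_of_nonadj_trans (hsymm : ∀ i j, A i j → A j i) (hirr : ∀ i, ¬ A i i)
    (htrans : ∀ i j k, (∃ l, A j l) → ¬ A i j → ¬ A j k → ¬ A i k) :
    sigPos (Matrix.toBilin' (Matrix.of fun i j ↦ if A i j then (1 : ℝ) else 0)).toQuadraticMap ≤ 1 := by
  set Q := (Matrix.toBilin' (Matrix.of fun i j ↦ if A i j then (1 : ℝ) else 0)).toQuadraticMap with hQ
  -- non-isolated vertices and the classes of non-adjacency
  set V : Finset σ := Finset.univ.filter fun i ↦ ∃ j, A i j with hV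
  have hV' : ∀ {i j}, A i j → i ∈ V := fun {i j} h ↦ by rw [hV, Finset.mem_filter]; exact ⟨Finset.mem_univ _, j, h⟩
  set cls : σ → Finset σ := fun i ↦ V.filter fun j ↦ ¬ A i j with hcls
  have hmem_cls : ∀ {i j}, j ∈ cls i ↔ j ∈ V ∧ ¬ A i j := fun {i j} ↦ by rw [hcls, Finset.mem_filter]
  have hself : ∀ {i}, i ∈ V → i ∈ cls i := fun {i} hi ↦ hmem_cls.2 ⟨hi, hirr i⟩
  have hcls_eq : ∀ {i j}, i ∈ V → j ∈ cls i → cls j = cls i := by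
    intro i j hi hj
    obtain ⟨hjV, hij⟩ := hmem_cls.1 hj
    have hji : ¬ A j i := fun h ↦ hij (hsymm _ _ h)
    obtain ⟨l, hl⟩ := (Finset.mem_filter.1 hi).2
    obtain ⟨l', hl'⟩ := (Finset.mem_filter.1 hjV).2
    ext k
    rw [hmem_cls, hmem_cls]
    exact ⟨fun ⟨hk, hjk⟩ ↦ ⟨hk, htrans i j k ⟨l', hl'⟩ hij hjk⟩, fun ⟨hk, hik⟩ ↦ ⟨hk, htrans j i k ⟨l, hl⟩ hji hik⟩⟩
  -- the linear functional `Σ_{V} x_i` and the class sums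
  set ℓ : (σ → ℝ) →ₗ[ℝ] ℝ := ∑ i ∈ V, LinearMap.proj i with hℓ
  have hℓx : ∀ x : σ → ℝ, ℓ x = ∑ i ∈ V, x i := fun x ↦ by
    rw [hℓ, LinearMap.sum_apply]; rfl
  -- `Σ_{i ∈ V} x_i T_i = Σ_{C} T_C²` where `T_i = Σ_{cls i} x`
  have hP : ∀ x : σ → ℝ, 0 ≤ ∑ i ∈ V, x i * ∑ j ∈ cls i, x j := by
    intro x
    rw [← Finset.sum_image' (s := V) (g := cls) (f := fun C ↦ (∑ j ∈ C, x j) * ∑ j ∈ C, x j)]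
    · exact Finset.sum_nonneg fun C _ ↦ mul_self_nonneg _
    · intro i hi
      -- the fiber of `cls i` is `cls i`
      have hfib : V.filter (fun j ↦ cls j = cls i) = cls i := by
        ext j
        rw [Finset.mem_filter, hmem_cls]
        constructor
        · rintro ⟨hjV, hj⟩
          have := hself hjV
          rw [hj] at this
          exact ⟨hjV, (hmem_cls.1 this).2⟩
        · rintro ⟨hjV, hij⟩
          exact ⟨hjV, hcls_eq hi (hmem_cls.2 ⟨hjV, hij⟩)⟩
      rw [hfib, Finset.sum_mul]
      refine Finset.sum_congr rfl fun j hj ↦ ?_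
      rw [hcls_eq hi hj]
  -- `Q x = (Σ_V x)² - Σ_{i ∈ V} x_i T_i`
  have hQx : ∀ x : σ → ℝ, Q x = (∑ i ∈ V, x i) * (∑ i ∈ V, x i) - ∑ i ∈ V, x i * ∑ j ∈ cls i, x j := by
    intro x
    rw [hQ, LinearMap.BilinMap.toQuadraticMap_apply, Matrix.toBilin'_apply, Finset.sum_mul, ← Finset.sum_sub_distrib]
    -- rows outside `V` vanish
    rw [← Finset.sum_subset (Finset.subset_univ V) fun i _ hi ↦ ?_]
    · refine Finset.sum_congr rfl fun i _ ↦ ?_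
      have hT : ∑ j ∈ cls i, x j = ∑ j ∈ V, if ¬ A i j then x j else 0 := by
        simp only [hcls, Finset.sum_filter]
      rw [hT, Finset.mul_sum, Finset.mul_sum, ← Finset.sum_sub_distrib]
      -- columns outside `V` vanish
      rw [← Finset.sum_subset (Finset.subset_univ V) fun j _ hj ↦ ?_]
      · refine Finset.sum_congr rfl fun j _ ↦ ?_
        rw [Matrix.of_apply]
        by_cases h : A i j
        · rw [if_pos h, if_neg (not_not.2 h)]; ring
        · rw [if_neg h, if_pos h]; ring
      · rw [Matrix.of_apply, if_neg (fun h ↦ hj (hV' (hsymm _ _ h))), mul_zero, zero_mul]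
    · refine Finset.sum_eq_zero fun j _ ↦ ?_
      rw [Matrix.of_apply, if_neg (fun h ↦ hi (hV' h)), mul_zero, zero_mul]
  have hN : ∀ x ∈ LinearMap.ker ℓ, Q x ≤ 0 := fun x hx ↦ by
    rw [LinearMap.mem_ker, hℓx] at hx
    rw [hQx, hx, mul_zero, zero_sub, neg_nonpos]
    exact hP x
  have h2 := QuadraticForm.sigPos_add_finrank_le_of_nonpos hN
  have hr : Module.finrank ℝ (LinearMap.range ℓ) ≤ 1 :=
    (Submodule.finrank_le _).trans (Module.finrank_self ℝ).le
  have h3 := ℓ.finrank_range_add_finrank_ker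
  omega

end Multipartite

/-! ## §3 Basis generating polynomials of matroids are Lorentzian -/

section Matroid

variable [Fintype σ] [DecidableEq σ]

omit [Fintype σ] in
/-- **Rank-`2` contractions of a matroid are complete multipartite**: for `J ⊆ {0,1}^σ` M-convex and any `α`, the relation
`i ~ j ⟺ α + e_i + e_j ∈ J` satisfies: `i ≁ j`, `j ≁ k`, `j ~ l` for some `l` `⟹ i ≁ k`. (Exchange between `α + e_j + e_l`
and `α + e_i + e_k` at the index `l` would give `α + e_j + e_i ∈ J` or `α + e_j + e_k ∈ J`.)
[cite: BrandenHuh2019, §2.2 (p. 11, basis exchange); §3.2 proof of Thm. 3.10] -/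
theorem nonadj_trans_of_isMConvex {J : Finset (σ →₀ ℕ)} (hM : IsMConvex (J : Set (σ →₀ ℕ))) (α : σ →₀ ℕ) (i j k : σ)
    (hj : ∃ l, α + Finsupp.single j 1 + Finsupp.single l 1 ∈ J)
    (hij : α + Finsupp.single i 1 + Finsupp.single j 1 ∉ J) (hjk : α + Finsupp.single j 1 + Finsupp.single k 1 ∉ J) :
    α + Finsupp.single i 1 + Finsupp.single k 1 ∉ J := by
  intro hik
  obtain ⟨l, hl⟩ := hj
  -- `l ≠ i, k`
  have hli : l ≠ i := by rintro rfl; rw [add_right_comm] at hl; exact hij hl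
  have hlk : l ≠ k := by rintro rfl; exact hjk hl
  have hK := hM.vadd_mem α
  -- exchange between `e_j + e_l` and `e_i + e_k` at `l`
  have hγ : Finsupp.single j 1 + Finsupp.single l 1 ∈ {γ : σ →₀ ℕ | α + γ ∈ (J : Set (σ →₀ ℕ))} := by
    rw [Set.mem_setOf_eq, ← add_assoc]; exact hl
  have hδ : Finsupp.single i 1 + Finsupp.single k 1 ∈ {γ : σ →₀ ℕ | α + γ ∈ (J : Set (σ →₀ ℕ))} := by
    rw [Set.mem_setOf_eq, ← add_assoc]; exact hik
  obtain ⟨m, hm, hmem⟩ := hK hγ hδ l (by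
    simp only [Finsupp.add_apply, Finsupp.single_apply, if_neg hli.symm, if_neg hlk.symm, if_true]
    omega)
  simp only [Finsupp.add_apply, Finsupp.single_apply] at hm
  -- `m ∈ {i, k}`
  have hmik : m = i ∨ m = k := by
    by_contra h
    push Not at h
    rw [if_neg (Ne.symm h.1), if_neg (Ne.symm h.2)] at hm
    omega
  -- the exchanged element is `e_j + e_m`
  have heq : Finsupp.single j 1 + Finsupp.single l 1 - Finsupp.single l 1 + Finsupp.single m 1 =
      Finsupp.single j 1 + Finsupp.single m 1 := by
    rw [add_tsub_cancel_right]
  rw [heq, Set.mem_setOf_eq, ← add_assoc, Finset.mem_coe] at hmem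
  rcases hmik with rfl | rfl
  · rw [add_right_comm] at hmem; exact hij hmem
  · exact hjk hmem

/-- The Hessian of `∂^α f_J` for squarefree `J`: `(𝓗_{∂^α f_J})_{ij} = [α + e_i + e_j ∈ J]` (the adjacency matrix of the
basis graph of the contraction `J/α`). [cite: BrandenHuh2019, §3.2 proof of Thm. 3.10; §2.4 Thm. 2.25] -/
theorem hessian_iterPderiv_genPoly {J : Finset (σ →₀ ℕ)} (hJ01 : ∀ α ∈ J, ∀ i, α i ≤ 1) (α : σ →₀ ℕ) :
    hessian (iterPderiv α (genPoly J)) =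
      Matrix.of fun i j ↦ if α + Finsupp.single i 1 + Finsupp.single j 1 ∈ J then (1 : ℝ) else 0 := by
  rw [hessian_iterPderiv_eq]
  ext i j
  rw [Matrix.of_apply, Matrix.of_apply, normCoeff_genPoly hJ01]

/-- **The basis generating polynomial of a matroid is Lorentzian** (Anari–Liu–Oveis Gharan–Vinzant; Brändén–Huh Thm. 3.10,
(3) ⇒ (2), for `J ⊆ {0,1}^n`): if `J ⊆ {0,1}^σ ∩ Δ^d` is M-convex — the set of bases of a rank-`d` matroid on `σ` — then
`f_J = Σ_{B ∈ J} Π_{i ∈ B} w_i ∈ L^d_n`. Proof by Theorem 2.25's criterion: `f_J ∈ M^d_n` and each `𝓗_{∂^α f_J}` is the adjacency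
matrix of a complete multipartite graph (§2, §3). [cite: BrandenHuh2019, §3.2 Thm. 3.10; §1 (p. 5, "the basis generating
polynomial of any matroid is Lorentzian" [ALOGV18])] -/
theorem genPoly_mem_lorentzian {J : Finset (σ →₀ ℕ)} {d : ℕ} (hJ01 : ∀ α ∈ J, ∀ i, α i ≤ 1) (hJd : ∀ α ∈ J, α.degree = d)
    (hM : IsMConvex (J : Set (σ →₀ ℕ))) : genPoly J ∈ lorentzian σ d := by
  match d with
  | 0 => exact mem_lorentzian_zero.2 ⟨isHomogeneous_genPoly hJd, coeff_genPoly_nonneg J⟩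
  | 1 => exact mem_lorentzian_one.2 ⟨isHomogeneous_genPoly hJd, coeff_genPoly_nonneg J⟩
  | m + 2 =>
    refine mem_lorentzian_iff_forall_sigPos_hessian.2
      ⟨⟨isHomogeneous_genPoly hJd, coeff_genPoly_nonneg J, by rw [support_genPoly]; exact hM⟩, fun α _ ↦ ?_⟩
    rw [hessian_iterPderiv_genPoly hJ01]
    refine sigPos_le_one_of_nonadj_trans _ (fun i j h ↦ by rwa [add_right_comm]) (fun i h ↦ ?_)
      (fun i j k hj hij hjk ↦ nonadj_trans_of_isMConvex hM α i j k hj hij hjk)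
    -- `α + 2e_i ∉ J` (not squarefree)
    have := hJ01 _ h i
    simp only [Finsupp.add_apply, Finsupp.single_eq_same] at this
    omega

/-- **The same for the bases of a uniform-matroid-like family given as finite sets**: if a nonempty family `𝓑` of `d`-subsets
of `σ` satisfies the basis exchange property, then `Σ_{B ∈ 𝓑} Π_{i ∈ B} w_i ∈ L^d_n` (read through `B ↦ e_B`).
[cite: BrandenHuh2019, §2.2 (p. 11, "The restriction of [M-convexity] to the subsets of `{0,1}^n` gives the family of matroids");
§3.2 Thm. 3.10] -/
theorem genPoly_image_ind_mem_lorentzian {𝓑 : Finset (Finset σ)} {d : ℕ} (hcard : ∀ B ∈ 𝓑, B.card = d)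
    (hM : IsMConvex ((𝓑.image ind : Finset (σ →₀ ℕ)) : Set (σ →₀ ℕ))) :
    genPoly (𝓑.image ind) ∈ lorentzian σ d := by
  refine genPoly_mem_lorentzian (fun α hα i ↦ ?_) (fun α hα ↦ ?_) hM
  · obtain ⟨B, -, rfl⟩ := Finset.mem_image.1 hα
    exact ind_le_one B i
  · obtain ⟨B, hB, rfl⟩ := Finset.mem_image.1 hα
    rw [degree_ind, hcard B hB]

end Matroid

end Literature.Combinatorics.LorentzianPolynomials

end
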